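import Summits.AtomisticToContinuum.Crystallization.Theorems.ChartedZeroExcessLayeredLatticeLiouvilleZZY

/-!
# Charted zero-excess layered lattices — Part ZZZ: rider R1 «WINDOW CONNECTIVITY» proved (part 3 of 3)

Route `ChartedPlanarOrder`, station L2′, lineage `stmt-AtomisticToContinuum-26636`; sequel of Parts ZZX (steering walks) and ZZY
(radial slope, level points, direction chains), whose module docstrings describe the whole argument.  This part: the LEG
(ZZY-4 numbering kept: `exists_leg` — follow a direction chain on the level surface `{φ = M}` by greedy walks between waypoints
`≤ 1` apart) and the ASSEMBLY (ZZY-5: ★ `windowConnected_of_dials` for any dial system `8 ≤ lo`, `14 ≤ M`, `lo + 85/32 ≤ M`,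
`M + 119/32 ≤ hi ≤ 43/2`; ★★ `windowConnected : … → WindowConnected S K Ψ τ` at the record band dial `M = 71/5` for both windows,
in the binder shape of `slabIso_package` — binders `hΨ hsurjΨ hclean hKfin hKne hK hfin`, all already carried by the skeleton, so
rider R1 costs NO new hypothesis).

0 sorry; standard axioms; no decide; no definitions.
-/

noncomputable section
open scoped RealInnerProductSpace
open Literature.Geometry.DiscreteGeometry (IsTwoShellGoodSet)
open Summit.AtomisticToContinuum.Crystallization.Theorems.ChartedPlanarOrderRigidityDoor (E3)

namespace Summit.AtomisticToContinuum.Crystallization.Theorems.ChartedZeroExcessLayeredLatticeLiouville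

/-! ### ZZY-4  The leg: following a direction chain on the level surface -/

/-- ★ THE LEG: from a window site within `85/64` of a level-`M` point on the ray `a`, for unit `b` with `⟪a, b⟫ ≥ −3/5`, a Barlow path
inside the window to a site within `85/64` of a level-`M` point on the ray `b` (greedy walks between consecutive waypoints of the
normalised interpolation chain; all waypoints at level `M`, consecutive ones `≤ 1` apart). -/
theorem exists_leg {S K : Set E3} {Ψ : ℤ × ℤ × ℤ → E3} {τ : ℤ → Bool} {x₀ : E3}
    (hΨ : IsBarlowBondChart S Set.univ Ψ τ) (hsurjΨ : ∀ p ∈ S, ∃ x, Ψ x = p)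
    (hclean : ∀ p ∈ S, IsTwoShellGoodSet (1 / 16) (9 / 10) 1 S p)
    (hKfin : K.Finite) (hKne : K.Nonempty) (hK : ∀ k ∈ K, dist k x₀ ≤ 4)
    (hfin : Set.Finite {x : ℤ × ℤ × ℤ | ∃ k ∈ K, dist (Ψ x) k ≤ 43 / 2})
    {lo hi M : ℝ} (hM14 : 14 ≤ M) (h1 : lo + 149 / 64 ≤ M) (h2 : M + 149 / 64 ≤ hi) (hhi : hi ≤ 43 / 2)
    {a b : E3} (ha : ‖a‖ = 1) (hb : ‖b‖ = 1) (hab : -(3 / 5) ≤ ⟪a, b⟫)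
    {ρa : ℝ} (hρa : 0 ≤ ρa) (hta : Metric.infDist (x₀ + ρa • a) K = M)
    {z : ℤ × ℤ × ℤ} (hz : z ∈ window S K Ψ lo hi) (hzt : dist (Ψ z) (x₀ + ρa • a) ≤ 85 / 64) :
    ∃ ρb : ℝ, 0 ≤ ρb ∧ Metric.infDist (x₀ + ρb • b) K = M ∧
      ∃ z' ∈ window S K Ψ lo hi, dist (Ψ z') (x₀ + ρb • b) ≤ 85 / 64 ∧
        Relation.ReflTransGen
          (fun p q => p ∈ window S K Ψ lo hi ∧ q ∈ window S K Ψ lo hi ∧ BarlowAdj τ p q) z z' := by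
  classical
  -- mesh: `N` waypoints, `(9/4)·(M + 4)·(10/N) ≤ 1`
  obtain ⟨N, hN⟩ : ∃ N : ℕ, (45 / 2 : ℝ) * (M + 4) ≤ N := ⟨⌈(45 / 2 : ℝ) * (M + 4)⌉₊, Nat.le_ceil _⟩
  have hN1 : 1 ≤ N := by
    have : (1 : ℝ) ≤ N := le_trans (by nlinarith) hN
    exact_mod_cast this
  have hNpos : (0 : ℝ) < N := by exact_mod_cast hN1
  obtain ⟨c, hc0, hcN, hc1, hcd⟩ := exists_dir_chain ha hb hab hN1
  -- level radii along the chain (`R 0 = ρa`)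
  have hM4 : (4 : ℝ) < M := by linarith
  choose ρ hρ0 hρe using fun i => exists_level_radius (x₀ := x₀) hKne hK (hc1 i) hM4
  set R : ℕ → ℝ := fun i => if i = 0 then ρa else ρ i with hR
  have hR0 : ∀ i, 0 ≤ R i := by
    intro i; simp only [hR]; split_ifs; exacts [hρa, hρ0 i]
  have hRe : ∀ i, Metric.infDist (x₀ + R i • c i) K = M := by
    intro i; simp only [hR]; split_ifs with h
    · subst h; rw [hc0]; exact hta
    · exact hρe i
  -- consecutive waypoints are `≤ 1` apart
  have hway : ∀ i < N, dist (x₀ + R i • c i) (x₀ + R (i + 1) • c (i + 1)) ≤ 1 := by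
    intro i hiN
    have hd := dist_level_points_le hKfin hKne hK (hc1 i) (hc1 (i + 1)) hM14 (hR0 i) (hR0 (i + 1)) (hRe i)
      (hRe (i + 1))
    have hRi : R i ≤ M + 4 := (level_radius_bounds hKne hK (hc1 i) (hR0 i) (hRe i)).2
    have hci := hcd i hiN
    calc dist (x₀ + R i • c i) (x₀ + R (i + 1) • c (i + 1)) ≤ 9 / 4 * (R i * ‖c i - c (i + 1)‖) := hd
      _ ≤ 9 / 4 * ((M + 4) * (10 / N)) := by gcongr
      _ = 45 / 2 * (M + 4) / N := by ring
      _ ≤ 1 := div_le_one_of_le₀ hN hNpos.le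
  -- stage induction along the chain
  have stage : ∀ i ≤ N, ∃ w ∈ window S K Ψ lo hi, dist (Ψ w) (x₀ + R i • c i) ≤ 85 / 64 ∧
      Relation.ReflTransGen
        (fun p q => p ∈ window S K Ψ lo hi ∧ q ∈ window S K Ψ lo hi ∧ BarlowAdj τ p q) z w := by
    intro i
    induction i with
    | zero =>
      intro _
      refine ⟨z, hz, ?_, Relation.ReflTransGen.refl⟩
      have hR00 : R 0 = ρa := by simp [hR]
      rw [hR00, hc0]; exact hzt
    | succ i ih =>
      intro hiN
      obtain ⟨w, hw, hwd, hpath⟩ := ih (by omega)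
      have hstart : dist (Ψ w) (x₀ + R (i + 1) • c (i + 1)) ≤ 149 / 64 := by
        have := hway i (by omega)
        linarith [dist_triangle (Ψ w) (x₀ + R i • c i) (x₀ + R (i + 1) • c (i + 1))]
      obtain ⟨w', hw', hw'd, hpath'⟩ := exists_path_toward_point hΨ hsurjΨ hclean hKne hfin
        (lo := lo) (hi := hi) (L := 149 / 64) (t := x₀ + R (i + 1) • c (i + 1))
        (by rw [hRe]; exact h1) (by rw [hRe]; exact h2) hhi hw hstart
      exact ⟨w', hw', by linarith, hpath.trans hpath'⟩
  obtain ⟨w, hw, hwd, hpath⟩ := stage N le_rfl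
  refine ⟨R N, hR0 N, ?_, w, hw, ?_, hpath⟩
  · have := hRe N; rwa [hcN] at this
  · rwa [hcN] at hwd

/-! ### ZZY-5  Assembly: window connectivity -/

/-- ★ WINDOW CONNECTIVITY FOR A DIAL SYSTEM: the window `(lo, hi)` is connected under Barlow steps inside itself whenever a band dial
`M` satisfies `8 ≤ lo`, `14 ≤ M`, `lo + 85/32 ≤ M`, `M + 119/32 ≤ hi ≤ 43/2`. -/
theorem windowConnected_of_dials {S K : Set E3} {Ψ : ℤ × ℤ × ℤ → E3} {τ : ℤ → Bool} {x₀ : E3}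
    (hΨ : IsBarlowBondChart S Set.univ Ψ τ) (hsurjΨ : ∀ p ∈ S, ∃ x, Ψ x = p)
    (hclean : ∀ p ∈ S, IsTwoShellGoodSet (1 / 16) (9 / 10) 1 S p)
    (hKfin : K.Finite) (hKne : K.Nonempty) (hK : ∀ k ∈ K, dist k x₀ ≤ 4)
    (hfin : Set.Finite {x : ℤ × ℤ × ℤ | ∃ k ∈ K, dist (Ψ x) k ≤ 43 / 2})
    {lo hi M : ℝ} (hlo : 8 ≤ lo) (hM14 : 14 ≤ M) (h1 : lo + 85 / 32 ≤ M) (h2 : M + 119 / 32 ≤ hi) (hhi : hi ≤ 43 / 2) :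
    ∀ y ∈ window S K Ψ lo hi, ∀ x ∈ window S K Ψ lo hi,
      Relation.ReflTransGen
        (fun p q => p ∈ window S K Ψ lo hi ∧ q ∈ window S K Ψ lo hi ∧ BarlowAdj τ p q) y x := by
  intro y hy x hx
  have hsymm : ∀ p q : ℤ × ℤ × ℤ, (p ∈ window S K Ψ lo hi ∧ q ∈ window S K Ψ lo hi ∧ BarlowAdj τ p q) →
      (q ∈ window S K Ψ lo hi ∧ p ∈ window S K Ψ lo hi ∧ BarlowAdj τ q p) :=
    fun p q h => ⟨h.2.1, h.1, barlowAdj_symm h.2.2⟩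
  have hM4 : (4 : ℝ) < M := by linarith
  -- walk both endpoints to the band `(M, M + 17/16]`
  obtain ⟨y', hy', hy'1, hy'2, hpy⟩ :=
    exists_path_to_band hΨ hsurjΨ hclean hKfin hKne hK hfin hlo (by linarith) hM14 (by linarith) hhi hy
  obtain ⟨x', hx', hx'1, hx'2, hpx⟩ :=
    exists_path_to_band hΨ hsurjΨ hclean hKfin hKne hK hfin hlo (by linarith) hM14 (by linarith) hhi hx
  -- the rays of the two band atoms and their level points
  have hry : 10 ≤ dist (Ψ y') x₀ := by linarith [infDist_sub_four_le_dist (p := Ψ y') hKne hK]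
  have hrx : 10 ≤ dist (Ψ x') x₀ := by linarith [infDist_sub_four_le_dist (p := Ψ x') hKne hK]
  have hy0 : Ψ y' - x₀ ≠ 0 := by
    intro h; rw [dist_eq_norm, h, norm_zero] at hry; linarith
  have hx0 : Ψ x' - x₀ ≠ 0 := by
    intro h; rw [dist_eq_norm, h, norm_zero] at hrx; linarith
  have hu : ‖‖Ψ y' - x₀‖⁻¹ • (Ψ y' - x₀)‖ = 1 := norm_smul_inv_norm hy0
  have hv : ‖‖Ψ x' - x₀‖⁻¹ • (Ψ x' - x₀)‖ = 1 := norm_smul_inv_norm hx0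
  obtain ⟨ρu, hρu, heu⟩ := exists_level_radius (x₀ := x₀) hKne hK hu hM4
  have hhopy : dist (Ψ y') (x₀ + ρu • (‖Ψ y' - x₀‖⁻¹ • (Ψ y' - x₀))) ≤ 85 / 64 :=
    hop_le hKfin hKne hK hM14 hy'1 hy'2 hρu heu
  obtain ⟨w, hw, huw, hwv⟩ := exists_mid_direction hu hv
  -- two legs along the level surface
  obtain ⟨ρw, hρw, hew, z₁, hz₁, hz₁d, hp₁⟩ := exists_leg hΨ hsurjΨ hclean hKfin hKne hK hfin hM14 (by linarith)
    (by linarith) hhi hu hw huw hρu heu hy' hhopy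
  obtain ⟨ρv, hρv, hev, z₂, hz₂, hz₂d, hp₂⟩ := exists_leg hΨ hsurjΨ hclean hKfin hKne hK hfin hM14 (by linarith)
    (by linarith) hhi hw hv hwv hρw hew hz₁ hz₁d
  -- the hop at `x′`, the last greedy walk toward the point `Ψ x′`, the one-bond hop onto `x′`, and `x`'s band walk reversed
  have hhopx : dist (Ψ x') (x₀ + ρv • (‖Ψ x' - x₀‖⁻¹ • (Ψ x' - x₀))) ≤ 85 / 64 :=
    hop_le hKfin hKne hK hM14 hx'1 hx'2 hρv hev
  have hstart : dist (Ψ z₂) (Ψ x') ≤ 85 / 32 := by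
    linarith [dist_triangle (Ψ z₂) (x₀ + ρv • (‖Ψ x' - x₀‖⁻¹ • (Ψ x' - x₀))) (Ψ x'),
      dist_comm (Ψ x') (x₀ + ρv • (‖Ψ x' - x₀‖⁻¹ • (Ψ x' - x₀)))]
  obtain ⟨z₃, hz₃, hz₃d, hp₃⟩ := exists_path_toward_point hΨ hsurjΨ hclean hKne hfin (lo := lo) (hi := hi)
    (L := 85 / 32) (t := Ψ x') (by linarith) (by linarith) hhi hz₂ hstart
  have hp₄ := reflTransGen_of_dist_le hΨ hz₃ hx' hz₃d
  have hp₅ := reflTransGen_reverse hsymm hpx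
  exact hpy.trans (hp₁.trans (hp₂.trans (hp₃.trans (hp₄.trans hp₅))))

/-- ★★ RIDER R1 «WINDOW CONNECTIVITY» DISCHARGED, in the binder shape of `slabIso_package` (band dial `M = 71/5` for both windows). -/
theorem windowConnected {S K : Set E3} {Ψ : ℤ × ℤ × ℤ → E3} {τ : ℤ → Bool} {x₀ : E3}
    (hΨ : IsBarlowBondChart S Set.univ Ψ τ) (hsurjΨ : ∀ p ∈ S, ∃ x, Ψ x = p)
    (hclean : ∀ p ∈ S, IsTwoShellGoodSet (1 / 16) (9 / 10) 1 S p)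
    (hKfin : K.Finite) (hKne : K.Nonempty) (hK : ∀ k ∈ K, dist k x₀ ≤ 4)
    (hfin : Set.Finite {x : ℤ × ℤ × ℤ | ∃ k ∈ K, dist (Ψ x) k ≤ 43 / 2}) : WindowConnected S K Ψ τ :=
  ⟨windowConnected_of_dials hΨ hsurjΨ hclean hKfin hKne hK hfin (lo := 81 / 8) (hi := 155 / 8) (M := 71 / 5)
      (by norm_num) (by norm_num) (by norm_num) (by norm_num) (by norm_num),
    windowConnected_of_dials hΨ hsurjΨ hclean hKfin hKne hK hfin (lo := 179 / 16) (hi := 293 / 16) (M := 71 / 5)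
      (by norm_num) (by norm_num) (by norm_num) (by norm_num) (by norm_num)⟩

end Summit.AtomisticToContinuum.Crystallization.Theorems.ChartedZeroExcessLayeredLatticeLiouville

end
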